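import Mathlib
import Literature.NumberTheory.EllipticCurves.MordellCurvePhiDescentHom
import Summits.BirchSwinnertonDyer.BirchSwinnertonDyer.Theorems.Rank2ObservatoryThreeIsoKField

/-!
# BirchSwinnertonDyer — rank ≥ 2 observatory, KERNEL-3ISO (B3b-2): conjugation and the norm cut

HONEST FRAMING: per-curve certified theorems and census instruments; no claim on BSD in rank ≥ 2.

The `Ê`-side value `δ₀ = t - θ₀C ∈ 𝓞 K` (`K = ℚ(ζ₃)`, file `Rank2ObservatoryThreeIsoIntegral`)
satisfies `δ₀ · ε₀ = n³` with `ε₀ = t + θ₀C = σ(δ₀)` for the non-trivial automorphism `σ : ζ ↦ ζ²`.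
Once `δ₀ = u · ∏_{q ∈ P} q^{k_q} · w³` (file `Rank2ObservatoryThreeIsoUFD`), applying `σ` and
comparing bad-prime exponents of `δ₀ ε₀ = n³` gives the NORM CUT `k_q + k_{c(q)} ≡ 0 (mod 3)`
for the conjugation partner `c(q) ~ σ(q)` — which kills the exponents of self-conjugate bad primes
(`θ₀`, inert `p`) and ties those of a split pair `π, π̄` (Cohen, *Number Theory I*, Prop. 8.4.8 (3):
"elements whose norm is trivial in `ℚ×/ℚ×³`").

* `prod_pow_exponents_unique` — (any domain) `u ∏_{q∈P} q^{a_q} x = v ∏_{q∈P} q^{b_q} y` with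
  `x, y` free of the pairwise non-associated primes `q ∈ P` and `u, v` units forces `a = b` on `P`;
* `exists_conj` — `K = ℚ(ζ₃)` has an automorphism `σ` with `σ ζ = ζ²` (power bases);
* `unit_eq_sign_mul_pow` — a unit of `𝓞 K` is `±ζ^j`, `j < 3` (Mathlib's `Units.mem`);
* `exists_normCut_class` — **the support law with norm cut**: under the hypotheses produced by
  B3b-1 and per-row factorisation data, `[δ₀] = [ζ^j ∏_{q ∈ P} q^{k_q}]` with `k_q < 3` and
  `k_q + k_{c q} ≡ 0 (mod 3)`.

No definitions. References: H. Cohen, *Number Theory I* (GTM 239, 2007), Prop. 8.4.8 (3);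
H. Cohen, F. Pazuki, arXiv:0903.4963, Prop. 2.2.
-/

set_option linter.dupNamespace false

noncomputable section

open NumberField

namespace Summit.BirchSwinnertonDyer.BirchSwinnertonDyer.Rank2Observatory.ThreeIso

open Literature.NumberTheory.EllipticCurves.MordellDescent

section Exponents

variable {R : Type*} [CommRing R] [IsDomain R] [DecidableEq R]

/-- A prime of the pairwise non-associated family `P` does not divide `u · ∏_{q ∈ P, q ≠ q₀} q^{b q} · y`
when `y` is `P`-free and `u` is a unit. [folklore] -/
theorem not_dvd_unit_mul_prod_erase_mul (P : Finset R) (hP : ∀ q ∈ P, Prime q)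
    (hna : ∀ q ∈ P, ∀ q' ∈ P, Associated q q' → q = q') {q₀ : R} (hq₀ : q₀ ∈ P)
    (u : Rˣ) (b : R → ℕ) {y : R} (hy : ∀ q ∈ P, ¬q ∣ y) :
    ¬q₀ ∣ (u : R) * (∏ q ∈ P.erase q₀, q ^ b q) * y := by
  have hq₀p := hP q₀ hq₀
  intro hd
  rcases hq₀p.dvd_or_dvd hd with hd | hd
  · rcases hq₀p.dvd_or_dvd hd with hd | hd
    · exact hq₀p.not_unit (isUnit_of_dvd_unit hd u.isUnit)
    · obtain ⟨q, hq, hdq⟩ := hq₀p.exists_mem_finset_dvd hd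
      have hqP : q ∈ P := Finset.mem_of_mem_erase hq
      have hassoc : Associated q₀ q :=
        hq₀p.irreducible.associated_of_dvd (hP q hqP).irreducible (hq₀p.dvd_of_dvd_pow hdq)
      exact Finset.ne_of_mem_erase hq (hna q₀ hq₀ q hqP hassoc).symm
  · exact hy q₀ hq₀ hd

/-- **Exponent uniqueness.** In a domain, if `u ∏_{q∈P} q^{a q} x = v ∏_{q∈P} q^{b q} y` with `P` a
finite family of pairwise non-associated primes, `u, v` units and `x, y` not divisible by any
`q ∈ P`, then `a = b` on `P`. [folklore] -/
theorem prod_pow_exponents_unique (P : Finset R) (hP : ∀ q ∈ P, Prime q)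
    (hna : ∀ q ∈ P, ∀ q' ∈ P, Associated q q' → q = q') (u v : Rˣ) (a b : R → ℕ) {x y : R}
    (hx : ∀ q ∈ P, ¬q ∣ x) (hy : ∀ q ∈ P, ¬q ∣ y)
    (h : (u : R) * (∏ q ∈ P, q ^ a q) * x = (v : R) * (∏ q ∈ P, q ^ b q) * y) :
    ∀ q ∈ P, a q = b q := by
  -- one inequality, by symmetry
  suffices key : ∀ (u v : Rˣ) (a b : R → ℕ) (x y : R), (∀ q ∈ P, ¬q ∣ x) → (∀ q ∈ P, ¬q ∣ y) →
      (u : R) * (∏ q ∈ P, q ^ a q) * x = (v : R) * (∏ q ∈ P, q ^ b q) * y → ∀ q ∈ P, a q ≤ b q by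
    intro q hq
    exact le_antisymm (key u v a b x y hx hy h q hq) (key v u b a y x hy hx h.symm q hq)
  intro u v a b x y hx hy h q₀ hq₀
  have hq₀p := hP q₀ hq₀
  -- `q₀^{a q₀} ∣ q₀^{b q₀} · (v ∏_{q ≠ q₀} q^{b q} y)` with the cofactor prime to `q₀`
  have hsplit : ∀ (c : R → ℕ), (∏ q ∈ P, q ^ c q) = q₀ ^ c q₀ * ∏ q ∈ P.erase q₀, q ^ c q :=
    fun c => (Finset.mul_prod_erase P (fun q => q ^ c q) hq₀).symm
  have hdvd : q₀ ^ a q₀ ∣ q₀ ^ b q₀ * ((v : R) * (∏ q ∈ P.erase q₀, q ^ b q) * y) := by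
    have : q₀ ^ a q₀ ∣ (u : R) * (∏ q ∈ P, q ^ a q) * x :=
      ⟨(u : R) * (∏ q ∈ P.erase q₀, q ^ a q) * x, by rw [hsplit a]; ring⟩
    rw [h, hsplit b] at this
    exact this.trans ⟨1, by ring⟩
  have hcop := not_dvd_unit_mul_prod_erase_mul P hP hna hq₀ v b hy
  have h1 : q₀ ^ a q₀ ∣ q₀ ^ b q₀ := hq₀p.pow_dvd_of_dvd_mul_right _ hcop hdvd
  exact (pow_dvd_pow_iff hq₀p.ne_zero hq₀p.not_unit).mp h1

end Exponents

section Conj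

variable {K : Type*} [Field K]

/-- `σ θ = -θ` for `θ = 2ζ + 1` and any ring map with `σ ζ = ζ²`. [folklore] -/
theorem conj_theta [CharZero K] {ζ : K} (hζ : IsPrimitiveRoot ζ 3) (σ : K →+* K)
    (hσ : σ ζ = ζ ^ 2) : σ (2 * ζ + 1) = -(2 * ζ + 1) := by
  have h := zeta_sq_add_zeta_add_one hζ
  rw [map_add, map_mul, map_one, map_ofNat, hσ]
  linear_combination 2 * h

variable [NumberField K] [IsCyclotomicExtension {3} ℚ K]

/-- **The conjugation of `ℚ(ζ₃)`**: an automorphism with `σ ζ = ζ²` (the two power bases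
generated by `ζ` and `ζ²` have the same minimal polynomial `Φ₃`). [folklore] -/
theorem exists_conj {ζ : K} (hζ : IsPrimitiveRoot ζ 3) : ∃ σ : K ≃ₐ[ℚ] K, σ ζ = ζ ^ 2 := by
  have hζ2 : IsPrimitiveRoot (ζ ^ 2) 3 := hζ.pow_of_coprime 2 (by norm_num)
  have h : minpoly ℚ (hζ.powerBasis ℚ).gen = minpoly ℚ (hζ2.powerBasis ℚ).gen := by
    rw [IsPrimitiveRoot.powerBasis_gen, IsPrimitiveRoot.powerBasis_gen,
      ← Polynomial.cyclotomic_eq_minpoly_rat hζ (by norm_num),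
      ← Polynomial.cyclotomic_eq_minpoly_rat hζ2 (by norm_num)]
  refine ⟨(hζ.powerBasis ℚ).equivOfMinpoly (hζ2.powerBasis ℚ) h, ?_⟩
  have := (hζ.powerBasis ℚ).equivOfMinpoly_gen (hζ2.powerBasis ℚ) h
  rwa [IsPrimitiveRoot.powerBasis_gen, IsPrimitiveRoot.powerBasis_gen] at this

/-- **Cube classes of units of `ℤ[ζ₃]`**: a unit is `±ζ^j`, `j < 3`.
[cite: Cohen2007NumberTheoryI, Prop. 8.4.8 (3)] (Mathlib: `IsCyclotomicExtension.Rat.Three.Units.mem`) -/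
theorem unit_eq_sign_mul_pow {ζ : K} (hζ : IsPrimitiveRoot ζ 3) (u : (𝓞 K)ˣ) :
    ∃ j : ℕ, j < 3 ∧ ∃ sgn : K, (sgn = 1 ∨ sgn = -1) ∧ ((u : 𝓞 K) : K) = sgn * ζ ^ j := by
  have hmem := IsCyclotomicExtension.Rat.Three.Units.mem hζ u
  have hη : (((IsPrimitiveRoot.isUnit (hζ.toInteger_isPrimitiveRoot) (by decide)).unit : (𝓞 K)ˣ) :
      𝓞 K) = hζ.toInteger := rfl
  have hηK : ((hζ.toInteger : 𝓞 K) : K) = ζ := rfl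
  simp only [List.mem_cons, List.mem_nil_iff, or_false] at hmem
  rcases hmem with h | h | h | h | h | h
  · exact ⟨0, by norm_num, 1, Or.inl rfl, by rw [h]; simp⟩
  · exact ⟨0, by norm_num, -1, Or.inr rfl, by rw [h]; simp⟩
  · exact ⟨1, by norm_num, 1, Or.inl rfl, by rw [h, hη, hηK]; simp⟩
  · exact ⟨1, by norm_num, -1, Or.inr rfl, by rw [h, Units.val_neg, hη]; simp⟩
  · exact ⟨2, by norm_num, 1, Or.inl rfl, by rw [h, Units.val_pow_eq_pow_val, hη]; simp [hηK]⟩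
  · exact ⟨2, by norm_num, -1, Or.inr rfl, by
      rw [h, Units.val_neg, Units.val_pow_eq_pow_val, hη]; simp [hηK]⟩

end Conj

end Summit.BirchSwinnertonDyer.BirchSwinnertonDyer.Rank2Observatory.ThreeIso
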